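import Summits.ValiantsHypothesis.ValiantsHypothesis.Theorems.LacunarySymmetroidMatrixDescartesCensusDoorA34IsotropicTangent
import Summits.ValiantsHypothesis.ValiantsHypothesis.Theorems.LacunarySymmetroidMatrixDescartesCensusDoorA34Lift
import Mathlib.Analysis.Matrix.Spectrum
import Mathlib.Analysis.Matrix.PosDef
import Mathlib.Analysis.Matrix.Order

/-!
# `MatrixDescartes` census — DOOR A at `(3,4)`: the DEFINITE-LETTER INERTIA LAW (an open-set sub-family of the door, all supports)

HONEST FRAMING.  Object-search cell `pub-symmetroid`, door-A seat `val-sym-door-p3` (g14); helper file beside the OPEN typed statement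
`DoorA34 = PosRootLawAt 3 4 18` (route item `Theses.LacunarySymmetroid.DoorA34`, stmt-ValiantsHypothesis-19980), asserted nowhere here.
The seat's EDGE-EXACTNESS mechanism (…IsotropicTangent, …DiagonalTriple, …CommonEigenvector) read on the DEFINITE-LETTER SECTOR of the door
(`Census.doorA34_on_of_sectors`: the door on a support is the definite-letter row plus the all-indefinite row `IIII`; the tree kills the
definite words only on the twelve supports of width `≤ 12`, by engine-2's LP certificates).  A nineteen has the `20` triple-sum monomials with
all `19` sign alternations (…FullAlternation), so on the edge `{x,y}` of the monomial tetrahedron the binary cubic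
`det(S_x + t S_y) = det S_x + tr(adj S_x·S_y) t + tr(adj S_y·S_x) t² + det S_y t³` (`Census.det_add_smul_fin_three`, …DoorA34Lift) has the sign pattern dictated by the
ranks of `3d_x, 2d_x+d_y, d_x+2d_y, 3d_y` in the table; write `V_xy ∈ {0,1,2,3}` for its number of sign changes (`edge_parities_of_nineteen`).
Two elementary facts about DEFINITE letters then pin `V`:
* `definite ⇒ adj ≻ 0` and `tr(P Q) > 0` for `P, Q ≻ 0` (Schur): two definite letters have edge signs `(σ_x, σ_y, σ_x, σ_y)`, so **`V_xy = 0` if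
  they have the same sign and `3` otherwise** (PAIR LAW, `definite_pair_count`);
* **definiteness propagates along a root-free ray** (`posDef_of_forall_det_add_smul_ne_zero`, any size, spectral theorem): `A ≻ 0`, `B` symmetric
  nonsingular, `det(A + tB) ≠ 0` for all `t > 0` ⇒ `B ≻ 0`.  So for a definite `S_x` and ANY letter `S_y` of a nineteen, `V_xy ∈ {0,3}` forces
  `S_y` definite (same / opposite sign): an INDEFINITE neighbour needs `V_xy ∈ {1,2}` (PROPAGATION LAW, `definite_indefinite_count`).
* **`card_posRoots_le_18_of_definite_letter`** — THE LAW (all supports `d`, decidable test): if letter `a` is definite and NO sign assignment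
  `σ : Fin 4 → {−,0,+}` with `σ a ≠ 0` satisfies [`V_xy = 3·[σ_x ≠ σ_y]` for `σ_x, σ_y ≠ 0`] and [`V_xy ∈ {1,2}` for `σ_x ≠ 0 = σ_y`], then `Z₊ ≤ 18`.
  This is a statement about an OPEN set of pencils (one definite letter, the other three arbitrary symmetric), not a lower-dimensional stratum.
* instances (`decide`): on `(0,1,7,11)` and `(0,2,9,12)` (two of the twelve `IIII`-residue supports of …Box12IIII) EVERY definite letter is
  obstructed — a nineteen there has four indefinite letters, for a structural reason and not by LP.
Located (this seat, `d₃ ≤ 30`, 2060 sorted 3-Sidon supports): the test obstructs 3400 of the 8240 pairs (support, definite letter), ALL four letters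
on 622 supports; it passes on `(0,2,5,26)` with a definite top letter, where …DefiniteTopSeventeen's pseudo-nineteen lives (no sign-level law can do
better there).  Nothing here bounds `ζ_sym(3,4)`; `DoorA34` stays OPEN; nothing on `MatrixDescartes` (stmt-18050) / `VP ≠ VNP`.
[folklore] Descartes' rule, the spectral theorem for real symmetric matrices, Schur's product theorem; elementary.
-/

open Polynomial Finset Matrix

-- `Summit.ValiantsHypothesis.ValiantsHypothesis.…` repeats a component by the D-0017 layout
-- (single-conjunct summit), which the `dupNamespace` linter flags; the name is mandated.
set_option linter.dupNamespace false

namespace Summit.ValiantsHypothesis.ValiantsHypothesis.Theorems.LacunarySymmetroidMatrixDescartes.Census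

/-! ## 1. Definiteness propagates along a root-free ray (any size) -/

/-- **Definiteness propagates along a root-free ray.**  If `A ≻ 0`, `B` is real symmetric and nonsingular, and
`det (A + t•B) ≠ 0` for every `t > 0`, then `B ≻ 0` (congruence by `A = YᵀY` and the spectral theorem for `Y⁻ᵀBY⁻¹`:
a non-positive eigenvalue `μ` is `0`, killing `det B`, or gives the root `t = −1/μ`). [folklore] -/
theorem posDef_of_forall_det_add_smul_ne_zero {n : Type*} [Fintype n] [DecidableEq n]
    {A B : Matrix n n ℝ} (hA : A.PosDef) (hB : B.IsHermitian) (hdet : B.det ≠ 0)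
    (h : ∀ t : ℝ, 0 < t → (A + t • B).det ≠ 0) : B.PosDef := by
  set U : Matrix n n ℝ := (hA.1.eigenvectorUnitary : Matrix n n ℝ) with hUdef
  set lam : n → ℝ := hA.1.eigenvalues with hlam
  have hlam_pos : ∀ i, 0 < lam i := fun i => hA.eigenvalues_pos i
  have hAeq : A = U * diagonal lam * star U := by simpa [Unitary.conjStarAlgAut_apply, hUdef, hlam] using hA.1.spectral_theorem
  have hUU : star U * U = 1 := Unitary.coe_star_mul_self _
  set E : Matrix n n ℝ := diagonal (fun i => Real.sqrt (lam i)) with hEdef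
  have hEE : E * E = diagonal lam := by
    rw [hEdef, diagonal_mul_diagonal]; congr 1; funext i; exact Real.mul_self_sqrt (hlam_pos i).le
  have hEstar : star E = E := by rw [star_eq_conjTranspose, hEdef, diagonal_conjTranspose]; congr 1
  set Y : Matrix n n ℝ := E * star U with hYdef
  have hY : A = star Y * Y := by
    rw [hYdef, star_mul, star_star, hEstar, hAeq, ← hEE]
    simp only [Matrix.mul_assoc]
  have hEdet : E.det ≠ 0 := by
    rw [hEdef, det_diagonal]; exact Finset.prod_ne_zero_iff.mpr fun i _ => (Real.sqrt_pos.mpr (hlam_pos i)).ne'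
  have hUdet : (star U).det ≠ 0 := fun h0 => by
    have := congrArg Matrix.det hUU
    rw [det_mul, h0, zero_mul, det_one] at this; exact zero_ne_one this
  have hYdet : Y.det ≠ 0 := by rw [hYdef, det_mul]; exact mul_ne_zero hEdet hUdet
  have hYdu : IsUnit Y.det := isUnit_iff_ne_zero.mpr hYdet
  have hYu : IsUnit Y := (isUnit_iff_isUnit_det Y).mpr hYdu
  set C : Matrix n n ℝ := star (Y⁻¹) * B * Y⁻¹ with hCdef
  have hC : C.IsHermitian := by
    rw [hCdef, star_eq_conjTranspose]; exact isHermitian_conjTranspose_mul_mul _ hB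
  have hBC : B = star Y * C * Y := by
    rw [hCdef]
    calc B = star (Y⁻¹ * Y) * B * (Y⁻¹ * Y) := by rw [nonsing_inv_mul Y hYdu, star_one, one_mul, mul_one]
      _ = star Y * (star Y⁻¹ * B * Y⁻¹) * Y := by rw [star_mul]; simp only [Matrix.mul_assoc]
  have hAt : ∀ t : ℝ, A + t • B = star Y * (1 + t • C) * Y := fun t => by
    rw [hY, hBC, Matrix.mul_add, Matrix.add_mul, Matrix.mul_one, Matrix.mul_smul, Matrix.smul_mul]
  by_contra hnot
  have hCnot : ¬ C.PosDef := fun hC' =>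
    hnot (by rw [hBC]; exact hYu.posDef_star_left_conjugate_iff.mpr hC')
  rw [hC.posDef_iff_eigenvalues_pos] at hCnot; push Not at hCnot
  obtain ⟨i, hi⟩ := hCnot
  rcases hi.lt_or_eq with hlt | heq
  · set μ := hC.eigenvalues i with hμ; have hv : C *ᵥ ⇑(hC.eigenvectorBasis i) = μ • ⇑(hC.eigenvectorBasis i) := hC.mulVec_eigenvectorBasis i
    have hv0 : (⇑(hC.eigenvectorBasis i) : n → ℝ) ≠ 0 := by
      simpa using hC.eigenvectorBasis.orthonormal.ne_zero i
    have ht : 0 < -1 / μ := div_pos_of_neg_of_neg (by norm_num) hlt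
    apply h (-1 / μ) ht
    rw [hAt, det_mul, det_mul]
    have hdet0 : (1 + (-1 / μ) • C).det = 0 := by
      refine Matrix.exists_mulVec_eq_zero_iff.mp ⟨_, hv0, ?_⟩
      rw [add_mulVec, one_mulVec, Matrix.smul_mulVec, hv, smul_smul,
        show -1 / μ * μ = -1 by rw [div_mul_cancel₀ _ hlt.ne], neg_one_smul, add_neg_cancel]
    rw [hdet0, mul_zero, zero_mul]
  · have hdetC : C.det = 0 := by
      rw [hC.det_eq_prod_eigenvalues]
      exact Finset.prod_eq_zero (Finset.mem_univ i) (by simp [heq])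
    apply hdet
    rw [hBC, det_mul, det_mul, hdetC, mul_zero, zero_mul]

/-! ## 2. Definite letters: determinant, adjugate and trace signs -/

/-- The adjugate of a positive definite matrix is positive definite (`adj S = det S • S⁻¹`). [folklore] -/
theorem adjugate_posDef_of_posDef {n : Type*} [Fintype n] [DecidableEq n] {S : Matrix n n ℝ} (h : S.PosDef) :
    S.adjugate.PosDef := by
  have hd : S.det ≠ 0 := h.det_pos.ne'
  have hadj : S.adjugate = S.det • S⁻¹ := by
    rw [Matrix.inv_def, smul_smul, Ring.inverse_eq_inv, mul_inv_cancel₀ hd, one_smul]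
  rw [hadj]
  exact h.inv.smul h.det_pos

/-- For a `3 × 3` NEGATIVE definite `S` the adjugate is still positive definite (`adj (−S) = adj S`). [folklore] -/
theorem adjugate_posDef_of_neg_posDef {S : Matrix (Fin 3) (Fin 3) ℝ} (h : (-S).PosDef) : S.adjugate.PosDef := by
  have hneg : (-S).adjugate = S.adjugate := by
    rw [← neg_one_smul ℝ S, Matrix.adjugate_smul]; simp
  rw [← hneg]; exact adjugate_posDef_of_posDef h

/-- `det (−S) = −det S` in odd size `3`, so a negative definite `3 × 3` matrix has negative determinant. [folklore] -/
theorem det_neg_of_neg_posDef {S : Matrix (Fin 3) (Fin 3) ℝ} (h : (-S).PosDef) : S.det < 0 := by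
  have := h.det_pos
  rw [Matrix.det_neg] at this; simp only [Fintype.card_fin] at this; linarith

/-- A `3 × 3` matrix is not both positive and negative definite. [folklore] -/
theorem not_neg_posDef_of_posDef {S : Matrix (Fin 3) (Fin 3) ℝ} (h : S.PosDef) : ¬ (-S).PosDef :=
  fun h' => by have := h.det_pos; have := det_neg_of_neg_posDef h'; linarith

/-- … and conversely. [folklore] -/
theorem not_posDef_of_neg_posDef {S : Matrix (Fin 3) (Fin 3) ℝ} (h : (-S).PosDef) : ¬ S.PosDef :=
  fun h' => not_neg_posDef_of_posDef h' h

/-- **`tr(P Q) > 0` for positive definite `P, Q`** (Schur: `P ⊙ Q ≻ 0`, evaluated at the all-ones vector). [folklore] -/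
theorem trace_mul_pos_of_posDef {n : Type*} [Fintype n] [DecidableEq n] [Nonempty n] {P Q : Matrix n n ℝ}
    (hP : P.PosDef) (hQ : Q.PosDef) : 0 < (P * Q).trace := by
  have h1 : (fun _ : n => (1 : ℝ)) ≠ 0 := fun h0 => by simpa using congrFun h0 (Classical.arbitrary n)
  have hpos := (hP.hadamard hQ).dotProduct_mulVec_pos h1
  have hQs : ∀ i j, Q j i = Q i j := fun i j => by simpa using hQ.1.apply i j
  have htr : (P * Q).trace = star (fun _ : n => (1 : ℝ)) ⬝ᵥ ((P ⊙ Q) *ᵥ fun _ => 1) := by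
    simp only [Matrix.trace, Matrix.diag, Matrix.mul_apply, dotProduct, mulVec, hadamard_apply, Pi.star_apply, star_trivial,
      mul_one, one_mul]
    exact Finset.sum_congr rfl fun i _ => Finset.sum_congr rfl fun j _ => by rw [hQs i j]
  rw [htr]; exact hpos

/-- `tr(P Q) < 0` for `P ≻ 0` and `Q ≺ 0`. [folklore] -/
theorem trace_mul_neg_of_posDef_negDef {n : Type*} [Fintype n] [DecidableEq n] [Nonempty n] {P Q : Matrix n n ℝ}
    (hP : P.PosDef) (hQ : (-Q).PosDef) : (P * Q).trace < 0 := by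
  have := trace_mul_pos_of_posDef hP hQ
  rw [Matrix.mul_neg, Matrix.trace_neg] at this; linarith

/-! ## 3. The edge cubic and its sign changes -/

/-- A cubic whose four coefficients have one strict sign does not vanish at a positive argument. [folklore] -/
theorem cubic_ne_zero_of_same_sign {c₀ c₁ c₂ c₃ t : ℝ} (ht : 0 < t) (h0 : c₀ ≠ 0) (h01 : 0 < c₀ * c₁) (h12 : 0 < c₁ * c₂)
    (h23 : 0 < c₂ * c₃) : c₀ + c₁ * t + c₂ * t ^ 2 + c₃ * t ^ 3 ≠ 0 := by
  have ht2 : 0 < t ^ 2 := by positivity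
  have ht3 : 0 < t ^ 3 := by positivity
  rcases lt_or_gt_of_ne h0 with h0 | h0
  · have h1 : c₁ < 0 := by nlinarith
    have h2 : c₂ < 0 := by nlinarith
    nlinarith [mul_neg_of_neg_of_pos h1 ht, mul_neg_of_neg_of_pos h2 ht2, mul_neg_of_neg_of_pos (by nlinarith : c₃ < 0) ht3]
  · have h1 : 0 < c₁ := by nlinarith
    have h2 : 0 < c₂ := by nlinarith
    nlinarith [mul_pos h1 ht, mul_pos h2 ht2, mul_pos (by nlinarith : 0 < c₃) ht3]

/-- Reading a Descartes sign relation: `0 < (−1)^m · w` means `m` even and `w > 0`, or `m` odd and `w < 0`. [folklore] -/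
theorem mod_two_of_neg_one_pow_mul_pos {m : ℕ} {w : ℝ} (h : 0 < (-1 : ℝ) ^ m * w) :
    (m % 2 = 0 ∧ 0 < w) ∨ (m % 2 = 1 ∧ w < 0) := by
  rcases Nat.mod_two_eq_zero_or_one m with hm | hm
  · left; refine ⟨hm, ?_⟩; rw [neg_one_pow_eq_pow_mod_two, hm, pow_zero, one_mul] at h; exact h
  · right; refine ⟨hm, ?_⟩; rw [neg_one_pow_eq_pow_mod_two, hm, pow_one] at h; linarith

/-- `0 < (−1)^m · w` with `w > 0` forces `m` even. [folklore] -/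
theorem mod_two_eq_zero_of_rel {m : ℕ} {w : ℝ} (h : 0 < (-1 : ℝ) ^ m * w) (hw : 0 < w) : m % 2 = 0 := by
  rcases mod_two_of_neg_one_pow_mul_pos h with ⟨p, _⟩ | ⟨_, w'⟩
  exacts [p, absurd hw (not_lt.mpr w'.le)]

/-- `0 < (−1)^m · w` with `w < 0` forces `m` odd. [folklore] -/
theorem mod_two_eq_one_of_rel {m : ℕ} {w : ℝ} (h : 0 < (-1 : ℝ) ^ m * w) (hw : w < 0) : m % 2 = 1 := by
  rcases mod_two_of_neg_one_pow_mul_pos h with ⟨_, w'⟩ | ⟨p, _⟩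
  exacts [absurd hw (not_lt.mpr w'.le), p]

/-- **Edge sign relations of a nineteen.**  For `19` distinct positive roots and an edge `{x,y}`, with `ρ` the rank function of the
triple-sum table, the consecutive coefficients `det S_x, tr(adj S_x·S_y), tr(adj S_y·S_x), det S_y` of the edge cubic satisfy Descartes'
alternation relations `0 < (−1)^{ρ+ρ'}·c·c'`. [folklore] -/
theorem edge_parities_of_nineteen (d : Fin 4 → ℕ) (S : Fin 4 → Matrix (Fin 3) (Fin 3) ℝ) {x y : Fin 4} (hxy : x ≠ y)
    (h19 : 19 ≤ ((Matrix.det (∑ l, ((X : ℝ[X]) ^ d l) • (S l).map C)).roots.toFinset.filter (fun t => 0 < t)).card)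
    (ρ : ℕ → ℕ) (hρ : ∀ e, ρ e = (((Finset.univ : Finset (Fin 4 × Fin 4 × Fin 4)).image
      (fun p => d p.1 + d p.2.1 + d p.2.2)).filter (· < e)).card) :
    0 < (-1 : ℝ) ^ (ρ (3 * d x) + ρ (2 * d x + d y)) * ((S x).det * ((S x).adjugate * S y).trace)
    ∧ 0 < (-1 : ℝ) ^ (ρ (2 * d x + d y) + ρ (2 * d y + d x)) * (((S x).adjugate * S y).trace * ((S y).adjugate * S x).trace)
    ∧ 0 < (-1 : ℝ) ^ (ρ (2 * d y + d x) + ρ (3 * d y)) * (((S y).adjugate * S x).trace * (S y).det) := by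
  classical
  set P : ℝ[X] := (∑ l, (X : ℝ[X]) ^ d l • (S l).map C).det with hPdef
  have hP0 : P ≠ 0 := fun h0 => by
    rw [h0, Polynomial.roots_zero, Multiset.toFinset_zero, Finset.filter_empty, Finset.card_empty] at h19; omega
  set T : Finset ℕ := (Finset.univ : Finset (Fin 4 × Fin 4 × Fin 4)).image (fun p => d p.1 + d p.2.1 + d p.2.2) with hTdef
  have hT20 : T.card ≤ 20 := card_tripleSums_le_of_collapse d id (fun _ => rfl) (by decide)
  have hsum3 : (Finset.univ : Finset (Fin 3 → Fin 4)).image (fun g => ∑ t, d (g t)) = T := sumset_three_eq_tripleSums d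
  have hZ : ((Finset.univ : Finset (Fin 3 → Fin 4)).image (fun g => ∑ t, d (g t))).card
      ≤ (P.roots.toFinset.filter (fun t => 0 < t)).card + 1 := by rw [hsum3]; omega
  have hsupp : P.support = T := by rw [← hsum3]; exact support_det_pencil_eq_sumset_of_sharp d S hP0 hZ
  have hZ' : P.support.card ≤ (P.roots.toFinset.filter (fun t => 0 < t)).card + 1 := by rw [hsupp]; omega
  have memT : ∀ a b c : Fin 4, d a + d b + d c ∈ P.support := fun a b c => by
    rw [hsupp, hTdef]; exact Finset.mem_image.mpr ⟨(a, b, c), Finset.mem_univ _, rfl⟩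
  have hrank : ∀ e, (P.support.filter (· < e)).card = ρ e := fun e => by rw [hρ, hsupp]
  have hc0 : P.coeff (3 * d x) = (S x).det := by
    rw [hPdef, coeff_det_pencil_three_mul d S x (cube_unique_of_nineteen d S h19 x)]
  have hc3 : P.coeff (3 * d y) = (S y).det := by
    rw [hPdef, coeff_det_pencil_three_mul d S y (cube_unique_of_nineteen d S h19 y)]
  have hc1 : P.coeff (2 * d x + d y) = ((S x).adjugate * S y).trace := by
    rw [hPdef, coeff_det_pencil_three_square d S hxy (square_unique_of_nineteen d S h19 hxy)]
  have hc2 : P.coeff (2 * d y + d x) = ((S y).adjugate * S x).trace := by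
    rw [hPdef, coeff_det_pencil_three_square d S hxy.symm (square_unique_of_nineteen d S h19 hxy.symm)]
  obtain ⟨m0, m3⟩ : 3 * d x ∈ P.support ∧ 3 * d y ∈ P.support :=
    ⟨by rw [show 3 * d x = d x + d x + d x by ring]; exact memT x x x, by rw [show 3 * d y = d y + d y + d y by ring]; exact memT y y y⟩
  have m1 : 2 * d x + d y ∈ P.support := by rw [show 2 * d x + d y = d x + d x + d y by ring]; exact memT x x y
  have m2 : 2 * d y + d x ∈ P.support := by rw [show 2 * d y + d x = d y + d y + d x by ring]; exact memT y y x
  have r1 := pow_rank_mul_coeff_mul_coeff_pos_of_sharp P hZ' m0 m1; have r2 := pow_rank_mul_coeff_mul_coeff_pos_of_sharp P hZ' m1 m2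
  have r3 := pow_rank_mul_coeff_mul_coeff_pos_of_sharp P hZ' m2 m3
  rw [hrank, hrank] at r1 r2 r3
  rw [hc0, hc1] at r1; rw [hc1, hc2] at r2; rw [hc2, hc3] at r3
  exact ⟨r1, r2, r3⟩

/-! ## 4. Pair law and propagation law -/

/-- **PAIR LAW.**  Two DEFINITE letters `S_x, S_y` of a nineteen: the number of sign changes on the edge `{x,y}` is `0` if they have the same
sign and `3` otherwise. [folklore] -/
theorem definite_pair_count (d : Fin 4 → ℕ) (S : Fin 4 → Matrix (Fin 3) (Fin 3) ℝ) {x y : Fin 4} (hxy : x ≠ y)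
    (hx : (S x).PosDef ∨ (-S x).PosDef) (hy : (S y).PosDef ∨ (-S y).PosDef)
    (h19 : 19 ≤ ((Matrix.det (∑ l, ((X : ℝ[X]) ^ d l) • (S l).map C)).roots.toFinset.filter (fun t => 0 < t)).card)
    (ρ : ℕ → ℕ) (hρ : ∀ e, ρ e = (((Finset.univ : Finset (Fin 4 × Fin 4 × Fin 4)).image
      (fun p => d p.1 + d p.2.1 + d p.2.2)).filter (· < e)).card) :
    (((S x).PosDef ↔ (S y).PosDef) →
      (ρ (3 * d x) + ρ (2 * d x + d y)) % 2 + (ρ (2 * d x + d y) + ρ (2 * d y + d x)) % 2 + (ρ (2 * d y + d x) + ρ (3 * d y)) % 2 = 0)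
    ∧ (¬ ((S x).PosDef ↔ (S y).PosDef) →
      (ρ (3 * d x) + ρ (2 * d x + d y)) % 2 + (ρ (2 * d x + d y) + ρ (2 * d y + d x)) % 2 + (ρ (2 * d y + d x) + ρ (3 * d y)) % 2 = 3) := by
  obtain ⟨r1, r2, r3⟩ := edge_parities_of_nineteen d S hxy h19 ρ hρ
  rcases hx with hx | hx <;> rcases hy with hy | hy
  · have a0 := hx.det_pos; have a1 := trace_mul_pos_of_posDef (adjugate_posDef_of_posDef hx) hy
    have a2 := trace_mul_pos_of_posDef (adjugate_posDef_of_posDef hy) hx; have a3 := hy.det_pos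
    rw [mod_two_eq_zero_of_rel r1 (mul_pos a0 a1), mod_two_eq_zero_of_rel r2 (mul_pos a1 a2), mod_two_eq_zero_of_rel r3 (mul_pos a2 a3)]
    exact ⟨fun _ => rfl, fun h => absurd (iff_of_true hx hy) h⟩
  · have a0 := hx.det_pos; have a1 := trace_mul_neg_of_posDef_negDef (adjugate_posDef_of_posDef hx) hy
    have a2 := trace_mul_pos_of_posDef (adjugate_posDef_of_neg_posDef hy) hx; have a3 := det_neg_of_neg_posDef hy
    rw [mod_two_eq_one_of_rel r1 (mul_neg_of_pos_of_neg a0 a1), mod_two_eq_one_of_rel r2 (mul_neg_of_neg_of_pos a1 a2),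
      mod_two_eq_one_of_rel r3 (mul_neg_of_pos_of_neg a2 a3)]
    exact ⟨fun h => absurd (h.mp hx) (not_posDef_of_neg_posDef hy), fun _ => rfl⟩
  · have a0 := det_neg_of_neg_posDef hx; have a1 := trace_mul_pos_of_posDef (adjugate_posDef_of_neg_posDef hx) hy
    have a2 := trace_mul_neg_of_posDef_negDef (adjugate_posDef_of_posDef hy) hx; have a3 := hy.det_pos
    rw [mod_two_eq_one_of_rel r1 (mul_neg_of_neg_of_pos a0 a1), mod_two_eq_one_of_rel r2 (mul_neg_of_pos_of_neg a1 a2),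
      mod_two_eq_one_of_rel r3 (mul_neg_of_neg_of_pos a2 a3)]
    exact ⟨fun h => absurd (h.mpr hy) (not_posDef_of_neg_posDef hx), fun _ => rfl⟩
  · have a0 := det_neg_of_neg_posDef hx; have a1 := trace_mul_neg_of_posDef_negDef (adjugate_posDef_of_neg_posDef hx) hy
    have a2 := trace_mul_neg_of_posDef_negDef (adjugate_posDef_of_neg_posDef hy) hx; have a3 := det_neg_of_neg_posDef hy
    rw [mod_two_eq_zero_of_rel r1 (mul_pos_of_neg_of_neg a0 a1), mod_two_eq_zero_of_rel r2 (mul_pos_of_neg_of_neg a1 a2),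
      mod_two_eq_zero_of_rel r3 (mul_pos_of_neg_of_neg a2 a3)]
    exact ⟨fun _ => rfl, fun h => absurd (iff_of_false (not_posDef_of_neg_posDef hx) (not_posDef_of_neg_posDef hy)) h⟩

/-- **PROPAGATION LAW.**  A DEFINITE letter `S_x` and a letter `S_y` of a nineteen that is neither positive nor negative definite: the edge
`{x,y}` has `1` or `2` sign changes (with `0` or `3` the edge cubic of `S_x + t(±S_y)` keeps one sign on `t > 0`, and definiteness propagates). [folklore] -/
theorem definite_indefinite_count (d : Fin 4 → ℕ) (S : Fin 4 → Matrix (Fin 3) (Fin 3) ℝ) (hS : ∀ l, (S l).IsSymm) {x y : Fin 4}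
    (hxy : x ≠ y) (hx : (S x).PosDef ∨ (-S x).PosDef) (hy : ¬ (S y).PosDef) (hy' : ¬ (-S y).PosDef)
    (h19 : 19 ≤ ((Matrix.det (∑ l, ((X : ℝ[X]) ^ d l) • (S l).map C)).roots.toFinset.filter (fun t => 0 < t)).card)
    (ρ : ℕ → ℕ) (hρ : ∀ e, ρ e = (((Finset.univ : Finset (Fin 4 × Fin 4 × Fin 4)).image
      (fun p => d p.1 + d p.2.1 + d p.2.2)).filter (· < e)).card) :
    (ρ (3 * d x) + ρ (2 * d x + d y)) % 2 + (ρ (2 * d x + d y) + ρ (2 * d y + d x)) % 2 + (ρ (2 * d y + d x) + ρ (3 * d y)) % 2 ≠ 0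
    ∧ (ρ (3 * d x) + ρ (2 * d x + d y)) % 2 + (ρ (2 * d x + d y) + ρ (2 * d y + d x)) % 2 + (ρ (2 * d y + d x) + ρ (3 * d y)) % 2
      ≠ 3 := by
  obtain ⟨r1, r2, r3⟩ := edge_parities_of_nineteen d S hxy h19 ρ hρ
  have hdx := det_letter_ne_zero_of_nineteen d S h19 x; have hdy := det_letter_ne_zero_of_nineteen d S h19 y
  have hHy : (S y).IsHermitian := by unfold Matrix.IsHermitian; rw [conjTranspose_eq_transpose_of_trivial]; exact hS y
  have hHy' : (-S y).IsHermitian := hHy.neg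
  have hdy' : (-S y).det ≠ 0 := by rw [Matrix.det_neg]; simpa using hdy
  -- the two cubics `det(S_x + t S_y)` and `det(S_x − t S_y)`
  have cub : ∀ t : ℝ, (S x + t • S y).det
      = (S x).det + ((S x).adjugate * S y).trace * t + ((S y).adjugate * S x).trace * t ^ 2 + (S y).det * t ^ 3 :=
    fun t => by rw [det_add_smul_fin_three]; ring
  have cub' : ∀ t : ℝ, (S x + t • (-S y)).det
      = (S x).det + (-((S x).adjugate * S y).trace) * t + ((S y).adjugate * S x).trace * t ^ 2 + (-(S y).det) * t ^ 3 := by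
    intro t; rw [smul_neg, ← neg_smul, det_add_smul_fin_three]; ring
  have negx : ∀ (t : ℝ) (B : Matrix (Fin 3) (Fin 3) ℝ), (-S x + t • B).det = -((S x + t • (-B)).det) := by
    intro t B
    rw [show -S x + t • B = -(S x + t • (-B)) by rw [smul_neg, neg_add, neg_neg], Matrix.det_neg, Fintype.card_fin]
    ring
  constructor
  · intro h0
    rcases mod_two_of_neg_one_pow_mul_pos r1 with ⟨p1, w1⟩ | ⟨p1, w1⟩ <;>
    rcases mod_two_of_neg_one_pow_mul_pos r2 with ⟨p2, w2⟩ | ⟨p2, w2⟩ <;>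
    rcases mod_two_of_neg_one_pow_mul_pos r3 with ⟨p3, w3⟩ | ⟨p3, w3⟩ <;> (try omega)
    -- all products positive: `det(S_x + t S_y)` has one sign
    have hne : ∀ t : ℝ, 0 < t → (S x + t • S y).det ≠ 0 := fun t ht => by
      rw [cub]; exact cubic_ne_zero_of_same_sign ht hdx w1 w2 w3
    rcases hx with hx | hx
    · exact hy (posDef_of_forall_det_add_smul_ne_zero hx hHy hdy hne)
    · refine hy' (posDef_of_forall_det_add_smul_ne_zero hx hHy' hdy' fun t ht => ?_)
      rw [negx, neg_neg]; exact neg_ne_zero.mpr (hne t ht)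
  · intro h3
    rcases mod_two_of_neg_one_pow_mul_pos r1 with ⟨p1, w1⟩ | ⟨p1, w1⟩ <;>
    rcases mod_two_of_neg_one_pow_mul_pos r2 with ⟨p2, w2⟩ | ⟨p2, w2⟩ <;>
    rcases mod_two_of_neg_one_pow_mul_pos r3 with ⟨p3, w3⟩ | ⟨p3, w3⟩ <;> (try omega)
    -- all products negative: `det(S_x − t S_y)` has one sign
    have hne : ∀ t : ℝ, 0 < t → (S x + t • (-S y)).det ≠ 0 := fun t ht => by
      rw [cub']; exact cubic_ne_zero_of_same_sign ht hdx (by nlinarith) (by nlinarith) (by nlinarith)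
    rcases hx with hx | hx
    · exact hy' (posDef_of_forall_det_add_smul_ne_zero hx hHy' hdy' hne)
    · refine hy (posDef_of_forall_det_add_smul_ne_zero hx hHy hdy fun t ht => ?_)
      rw [negx]; simpa using hne t ht

/-! ## 5. The definite-letter inertia law -/

/-- **DEFINITE-LETTER INERTIA LAW (all supports).**  Let a real symmetric `3 × 3` four-letter lacunary pencil have a DEFINITE letter `S_a`.  Let
`V x y` be the number of odd sums among `ρ(3d_x)+ρ(2d_x+d_y)`, `ρ(2d_x+d_y)+ρ(2d_y+d_x)`, `ρ(2d_y+d_x)+ρ(3d_y)` (`ρ` = rank in the triple-sum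
table).  If no sign assignment `σ : Fin 4 → SignType` with `σ a ≠ 0` has `V x y = 3·[σ x ≠ σ y]` whenever `σ x, σ y ≠ 0` and `V x y ∈ {1,2}`
whenever `σ x ≠ 0 = σ y`, then the determinant has at most `18` distinct positive roots. [folklore] -/
theorem card_posRoots_le_18_of_definite_letter (d : Fin 4 → ℕ) (S : Fin 4 → Matrix (Fin 3) (Fin 3) ℝ) (hS : ∀ l, (S l).IsSymm)
    (a : Fin 4) (ha : (S a).PosDef ∨ (-S a).PosDef)
    (ρ : ℕ → ℕ) (hρ : ∀ e, ρ e = (((Finset.univ : Finset (Fin 4 × Fin 4 × Fin 4)).image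
      (fun p => d p.1 + d p.2.1 + d p.2.2)).filter (· < e)).card)
    (V : Fin 4 → Fin 4 → ℕ)
    (hV : ∀ x y : Fin 4, x ≠ y → V x y = (ρ (3 * d x) + ρ (2 * d x + d y)) % 2
        + (ρ (2 * d x + d y) + ρ (2 * d y + d x)) % 2 + (ρ (2 * d y + d x) + ρ (3 * d y)) % 2)
    (htest : ∀ σ : Fin 4 → SignType, σ a ≠ 0 →
        (∀ x y : Fin 4, x ≠ y → σ x ≠ 0 → σ y ≠ 0 → V x y = if σ x = σ y then 0 else 3) →
        (∀ x y : Fin 4, x ≠ y → σ x ≠ 0 → σ y = 0 → V x y ≠ 0 ∧ V x y ≠ 3) → False) :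
    ((Matrix.det (∑ l, ((X : ℝ[X]) ^ d l) • (S l).map C)).roots.toFinset.filter (fun t => 0 < t)).card ≤ 18 := by
  classical
  by_contra hlt; push Not at hlt
  have h19 : 19 ≤ ((Matrix.det (∑ l, ((X : ℝ[X]) ^ d l) • (S l).map C)).roots.toFinset.filter (fun t => 0 < t)).card := by omega
  let σ : Fin 4 → SignType := fun x => if (S x).PosDef then 1 else if (-S x).PosDef then -1 else 0
  have hσdef : ∀ x, σ x ≠ 0 → (S x).PosDef ∨ (-S x).PosDef := fun x hx => by
    by_contra h; push Not at h; exact hx (by simp [σ, h.1, h.2])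
  have hσpos : ∀ x, (S x).PosDef → σ x = 1 := fun x hx => by simp [σ, hx]
  have hσneg : ∀ x, (-S x).PosDef → σ x = -1 := fun x hx => by
    have hnx : ¬ (S x).PosDef := not_posDef_of_neg_posDef hx; simp [σ, hx, hnx]
  refine htest σ ?_ ?_ ?_
  · rcases ha with ha | ha
    · rw [hσpos a ha]; decide
    · rw [hσneg a ha]; decide
  · intro x y hxy hx hy
    have hx' := hσdef x hx; have hy' := hσdef y hy
    obtain ⟨hsame, hdiff⟩ := definite_pair_count d S hxy hx' hy' h19 ρ hρ
    rw [hV x y hxy]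
    rcases hx' with hx' | hx' <;> rcases hy' with hy' | hy'
    · rw [hsame (iff_of_true hx' hy'), hσpos x hx', hσpos y hy']; decide
    · rw [hdiff (fun h => not_posDef_of_neg_posDef hy' (h.mp hx')), hσpos x hx', hσneg y hy']; decide
    · rw [hdiff (fun h => not_posDef_of_neg_posDef hx' (h.mpr hy')), hσneg x hx', hσpos y hy']; decide
    · rw [hsame (iff_of_false (not_posDef_of_neg_posDef hx') (not_posDef_of_neg_posDef hy')), hσneg x hx', hσneg y hy']
      decide
  · intro x y hxy hx hy
    have hx' := hσdef x hx
    have hny : ¬ (S y).PosDef := fun h => by rw [hσpos y h] at hy; exact absurd hy (by decide)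
    have hny' : ¬ (-S y).PosDef := fun h => by rw [hσneg y h] at hy; exact absurd hy (by decide)
    rw [hV x y hxy]
    exact definite_indefinite_count d S hS hxy hx' hny hny' h19 ρ hρ

/-! ## 6. Instances: on `(0,1,7,11)` and `(0,2,9,12)` every definite letter is obstructed -/

/-- **`(0,1,7,11)`: a nineteen has four indefinite letters.**  A real symmetric pencil on `(0,1,7,11)` with a definite letter has at most `18`
distinct positive determinant roots (the test of `card_posRoots_le_18_of_definite_letter` fails for every `a`, by `decide`). [folklore] -/
theorem card_posRoots_le_18_of_definite_letter_on_0_1_7_11 (S : Fin 4 → Matrix (Fin 3) (Fin 3) ℝ) (hS : ∀ l, (S l).IsSymm)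
    (a : Fin 4) (ha : (S a).PosDef ∨ (-S a).PosDef) :
    ((Matrix.det (∑ l, ((X : ℝ[X]) ^ ((![0, 1, 7, 11] : Fin 4 → ℕ)) l) • (S l).map C)).roots.toFinset.filter (fun t => 0 < t)).card
      ≤ 18 := by
  have hT : ((Finset.univ : Finset (Fin 4 × Fin 4 × Fin 4)).image
      (fun p => (![0, 1, 7, 11] : Fin 4 → ℕ) p.1 + (![0, 1, 7, 11] : Fin 4 → ℕ) p.2.1 + (![0, 1, 7, 11] : Fin 4 → ℕ) p.2.2))
        = ({0, 1, 2, 3, 7, 8, 9, 11, 12, 13, 14, 15, 18, 19, 21, 22, 23, 25, 29, 33} : Finset ℕ) := by decide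
  refine card_posRoots_le_18_of_definite_letter _ S hS a ha
    (fun e => ((({0, 1, 2, 3, 7, 8, 9, 11, 12, 13, 14, 15, 18, 19, 21, 22, 23, 25, 29, 33} : Finset ℕ)).filter (· < e)).card)
    (fun e => by rw [hT]) (![![0, 3, 0, 1], ![3, 0, 3, 2], ![0, 3, 0, 3], ![1, 2, 3, 0]]) (by decide) ?_
  clear ha; revert a; decide

/-- **`(0,2,9,12)`: a nineteen has four indefinite letters** (same statement on the support `(0,2,9,12)`). [folklore] -/
theorem card_posRoots_le_18_of_definite_letter_on_0_2_9_12 (S : Fin 4 → Matrix (Fin 3) (Fin 3) ℝ) (hS : ∀ l, (S l).IsSymm)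
    (a : Fin 4) (ha : (S a).PosDef ∨ (-S a).PosDef) :
    ((Matrix.det (∑ l, ((X : ℝ[X]) ^ ((![0, 2, 9, 12] : Fin 4 → ℕ)) l) • (S l).map C)).roots.toFinset.filter (fun t => 0 < t)).card
      ≤ 18 := by
  have hT : ((Finset.univ : Finset (Fin 4 × Fin 4 × Fin 4)).image
      (fun p => (![0, 2, 9, 12] : Fin 4 → ℕ) p.1 + (![0, 2, 9, 12] : Fin 4 → ℕ) p.2.1 + (![0, 2, 9, 12] : Fin 4 → ℕ) p.2.2))
        = ({0, 2, 4, 6, 9, 11, 12, 13, 14, 16, 18, 20, 21, 23, 24, 26, 27, 30, 33, 36} : Finset ℕ) := by decide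
  refine card_posRoots_le_18_of_definite_letter _ S hS a ha
    (fun e => ((({0, 2, 4, 6, 9, 11, 12, 13, 14, 16, 18, 20, 21, 23, 24, 26, 27, 30, 33, 36} : Finset ℕ)).filter (· < e)).card)
    (fun e => by rw [hT]) (![![0, 3, 0, 1], ![3, 0, 1, 0], ![0, 1, 0, 3], ![1, 0, 3, 0]]) (by decide) ?_
  clear ha; revert a; decide

end Summit.ValiantsHypothesis.ValiantsHypothesis.Theorems.LacunarySymmetroidMatrixDescartes.Census
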